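import Mathlib.Algebra.Ring.Action.Submonoid
import Mathlib.GroupTheory.Index
import Mathlib.GroupTheory.Perm.Cycle.Type
import Mathlib.RingTheory.PrincipalIdealDomain
import Mathlib.Tactic.Module
import Literature.NumberTheory.EllipticCurves.IsogenyDualProofs
import HarnessLib

/-!
# Kummer extensions of a rational point degenerate on one end of every `p`-isogeny (the structural
# lemma behind Matar–Nekovář's objection to Gross 1991 Prop. 9.3 at reducible `E[p]`; PROVED, no named fact)

Context. Gross, *Kolyvagin's work on modular elliptic curves* (LMS LN 153, 1991), Prop. 9.3, asserts
— for `p` odd and `Gal(ℚ(E_p)/ℚ) ≅ GL₂(ℤ/pℤ)` — that for a finite subgroup `S ⊂ H¹(K, E_p)` the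
extension `L_S/L`, `L = K(E_p)`, has `Gal(L_S/L) ≅ Hom(S, E_p)`; for `S = ⟨δ y_K⟩` this says that
`Gal(L(y_K/p)/L) ≅ E_p` is the WHOLE of `E[p]`. Its proof uses "Since `E_p` is a simple `𝒢`-module"
(Matar–Nekovář, JTNB **31** (2019), Prop. 6.4 (C5) and its proof, p. 498: "(C5) … used … in the
proof of [Gross, Prop. 9.3]"; sharpened to ABSOLUTE irreducibility in the 2021 correction,
JTNB **33**, pp. 627–628). Grigorov–Jorza–Patrikis–Stein–Tarniţă (Math. Comp. 78 (2009), §5.1) and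
Lawson–Wuthrich (Springer PROMS 188 (2016), §5 Thm. 14) claim that only `Hⁱ(K(E_p)/K, E_p) = 0`,
`i = 1, 2`, is needed; Matar–Nekovář (§0.10–0.11) call this "unjustified". The present file proves,
in the kernel, the elementary fact that makes the objection CONCRETE at a prime `p` where `E[p]` is
reducible, i.e. where there is a `K`-rational `p`-isogeny `φ : E → E'` (so `C = ker φ ⊂ E[p]` is a
`G_K`-stable line):

* **Kummer degeneration through an isogeny** (`exists_root_iff_exists_fixed_apply_eq`): for
  isogenies `φ : E → E'`, `φ̂ : E' → E` over a field `F` with `φ̂ ∘ φ = [m]`, and `y ∈ E(F̄)`,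
  THERE IS an `m`-th root `Q` of `y` (`m • Q = y`) with `σQ − Q ∈ ker φ` for EVERY `σ ∈ G_F`
  **iff** `y ∈ φ̂(E'(F))`. In that case the Kummer extension `F(E[m], Q)/F(E[m])` has Galois group
  inside `ker φ ≅ ℤ/m`, NOT `E[m]` — the conclusion of Gross's Prop. 9.3 for `S = ⟨δy⟩` fails.
* **The image point always degenerates** (`exists_root_map_forall_smul_sub_mem_ker`): for
  `y ∈ E(F)` the point `φ(y) ∈ E'(F)` has an `m`-th root `Q'` with `σQ' − Q' ∈ ker φ̂` for all `σ`.
* **Dichotomy on a `p`-isogeny edge** (`exists_root_or_generates`, `not_exists_root_and_generates`):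
  `p` prime, `φ̂ ∘ φ = [p]`, `E(F)` without `p`-torsion, `E'(F) = ℤy' + pE'(F)` cyclic modulo `p`.
  Then for every `y ∈ E(F)`: EITHER `y` has a `p`-th root `Q` with `σQ − Q ∈ ker φ` for all
  `σ ∈ G_F` (Case A: `y ∈ φ̂(E'(F))`), OR `φ(y)` generates `E'(F)` modulo `p`
  (Case B: `E'(F) = ℤφ(y) + pE'(F)`, i.e. `E'` passes the "`p ∤` index" certificate with the point
  `φ(y)` — and then, by the previous item, it is `φ(y)` on `E'` whose Kummer extension degenerates,
  inside `ker φ̂`); and NOT BOTH as soon as `y ∉ pE(F)`.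
* **Index currency** (`…_of_not_dvd_index`, `not_dvd_index_of_generates`,
  `exists_root_xor_generates_of_not_dvd_index`): `p ∤ [A : ℤy]`, `y` of infinite order ⇔-style
  translation to and from "cyclic modulo `p`" — the Heegner-index certificate `p ∤ [E(K) : ℤy_K]`
  (`m₀ = 0`) of the tree's Kolyvagin binders (`LawsonWuthrich2016.thm14_…`, `MatarNekovar2019.thm03_…`).

So at a pair `(E, p)` with a rational `p`-isogeny and a point `y_K` with `p ∤ [E(K) : ℤy_K]`
(Kolyvagin's certificate case), on EXACTLY one end of the edge `E — E'` the certified point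
(`y_K`, resp. `φ(y_K)`) has its Kummer extension over `K(E[p])` with group inside the isogeny
kernel: the conclusion of Gross's Prop. 9.3 (feeding 9.5 (1) `H/I ≅ E_p`) fails there — §2.3 (i) of
the cell `bsd-litref` audit sheet `run/shared/lean/pub/bsd-litref/lw16/sheets/D-AUDIT-lw16-r1.md`
(flag `LW16-Thm14-disputed-MN19-0.11`; sheet §7 (c) asked for this lemma), companion of
`MatarNekovar2019/ReducibleEigenline.lean` ((C6) fails at every reducible pair). Elementary
algebra of the tree's `WeierstrassCurve.Isogeny` on `geomPoints` (`Isogeny.map_smul`,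
`Isogeny.surjective` = Silverman *AEC* II.2.3); `E(F)` := the `Γ_F`-fixed subgroup (Mathlib
`FixedPoints.addSubgroup`; = the `F`-points, `fixedPoints_eq_range_map_holds`). Nothing is
asserted about Kolyvagin's bound and nothing here proves BSD for any pair; theorems only, no `def`,
no named fact. Homed Summits-side (`Rank1Residual/LW16/`, namespace `…LW16.IsogenyEdge`) next to the
re-route records of seat `bsd-litref-lw16-pv`, because the dichotomy is the audit's own lemma, not a
published statement (Literature/ is cited-only). Typer seat `bsd-litref-lw16-ty`.
-/

noncomputable section

open scoped Classical
open WeierstrassCurve Field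

universe u
namespace Summit.BirchSwinnertonDyer.Rank1Residual.LW16.IsogenyEdge

/-! ### §1 Pure algebra: a pair `g ∘ f = [p]` between groups, one of them cyclic modulo `p` -/

section Algebra

variable {M M' : Type*} [AddCommGroup M] [AddCommGroup M']

/-- **At least one end of a `p`-edge is divisible.** Let `A ≤ M`, `A' ≤ M'` be subgroups,
`f : M → M'`, `g : M' → M` homomorphisms with `g (f a) = p • a` (`p` prime), `g(A') ⊆ A`, `A`
without `p`-torsion, and `A' = ℤy' + pA'` for some `y' ∈ A'`. Then every `y ∈ A` with `f y ∈ A'`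
is EITHER a value `g a'`, `a' ∈ A'`, OR `f y` generates `A'` modulo `p`: `A' = ℤ·f y + pA'`.
(Write `f y = n y' + p b'`; if `p ∣ n` then `f y = p c'` and `p (y − g c') = 0`; if `p ∤ n`, Bézout.)
[folklore] -/
theorem exists_apply_eq_or_generates (A : AddSubgroup M) (A' : AddSubgroup M') (f : M →+ M')
    (g : M' →+ M) {p : ℕ} (hp : p.Prime) (hgf : ∀ a, g (f a) = (p : ℤ) • a)
    (hgA : ∀ a' ∈ A', g a' ∈ A) (htf : ∀ a ∈ A, (p : ℤ) • a = 0 → a = 0)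
    {y' : M'} (hy' : y' ∈ A') (hgen : ∀ a' ∈ A', ∃ n : ℤ, ∃ b' ∈ A', a' = n • y' + (p : ℤ) • b')
    {y : M} (hy : y ∈ A) (hfy : f y ∈ A') :
    (∃ a' ∈ A', g a' = y) ∨ ∀ a' ∈ A', ∃ n : ℤ, ∃ b' ∈ A', a' = n • f y + (p : ℤ) • b' := by
  obtain ⟨n, b', hb', hfy'⟩ := hgen (f y) hfy
  by_cases hpn : (p : ℤ) ∣ n
  · obtain ⟨k, rfl⟩ := hpn
    left
    have hc' : k • y' + b' ∈ A' := A'.add_mem (A'.zsmul_mem hy' k) hb'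
    refine ⟨k • y' + b', hc', ?_⟩
    have h1 : f y = (p : ℤ) • (k • y' + b') := by rw [hfy']; module
    have h2 : (p : ℤ) • (y - g (k • y' + b')) = 0 := by
      rw [smul_sub, ← hgf, ← map_zsmul g, ← h1, sub_self]
    have h3 := htf _ (A.sub_mem hy (hgA _ hc')) h2
    exact (sub_eq_zero.mp h3).symm
  · right
    have hpZ : Prime (p : ℤ) := Nat.prime_iff_prime_int.mp hp
    obtain ⟨u, v, huv⟩ := (Prime.coprime_iff_not_dvd hpZ).mpr hpn
    intro a' ha'
    obtain ⟨n₁, b₁, hb₁, ha'₁⟩ := hgen a' ha'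
    refine ⟨n₁ * v, n₁ • (u • y' - v • b') + b₁,
      A'.add_mem (A'.zsmul_mem (A'.sub_mem (A'.zsmul_mem hy' u) (A'.zsmul_mem hb' v)) n₁) hb₁, ?_⟩
    have hy'' : y' = v • f y + (p : ℤ) • (u • y' - v • b') := by
      linear_combination (norm := module) (-1 : ℤ) • congr($huv • y') - v • hfy'
    rw [ha'₁]
    nth_rw 1 [hy'']
    module

/-- **Not both.** With `f`, `g`, `g ∘ f = [p]`, `g(A') ⊆ A` as above and `y ∈ A` NOT in `pA`:
if `y = g a'` with `a' ∈ A'`, then `a' ∉ ℤ·f y + pA'` (else `y = g a' = p (n y + g b') ∈ pA`). In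
particular `f y` does not generate `A'` modulo `p`. [folklore] -/
theorem not_exists_eq_zsmul_add_of_apply_eq (A : AddSubgroup M) (A' : AddSubgroup M')
    (f : M →+ M') (g : M' →+ M) {p : ℕ} (hgf : ∀ a, g (f a) = (p : ℤ) • a)
    (hgA : ∀ a' ∈ A', g a' ∈ A) {y : M} (hy : y ∈ A) (hyp : ∀ b ∈ A, y ≠ (p : ℤ) • b)
    {a' : M'} (ha' : g a' = y) :
    ¬ ∃ n : ℤ, ∃ b' ∈ A', a' = n • f y + (p : ℤ) • b' := by
  rintro ⟨n, b', hb', h⟩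
  refine hyp (n • y + g b') (A.add_mem (A.zsmul_mem hy n) (hgA b' hb')) ?_
  have h1 : y = n • g (f y) + (p : ℤ) • g b' := by
    calc y = g a' := ha'.symm
      _ = n • g (f y) + (p : ℤ) • g b' := by rw [h, map_add, map_zsmul, map_zsmul]
  rw [hgf] at h1
  linear_combination (norm := module) h1

/-! ### §1b Index currency: `p ∤ [A : ℤy]` versus "cyclic modulo `p`" -/

variable {A : Type*} [AddCommGroup A]

/-- `p ∤ [A : ℤy]` with `y` of infinite order ⇒ `A` has no `p`-torsion: if `p a = 0` then
`[A : ℤy] • a = k • y` with `p k y = 0`, so `k = 0`, and `gcd([A:ℤy], p) = 1` kills `a`. [folklore] -/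
theorem eq_zero_of_prime_smul_eq_zero_of_not_dvd_index {p : ℕ} (hp : p.Prime) {y : A}
    (hy : ¬ IsOfFinAddOrder y) (hidx : ¬ p ∣ (AddSubgroup.zmultiples y).index) {a : A}
    (ha : (p : ℤ) • a = 0) : a = 0 := by
  set N := (AddSubgroup.zmultiples y).index with hN
  obtain ⟨k, hk⟩ := AddSubgroup.mem_zmultiples_iff.mp (AddSubgroup.nsmul_index_mem
    (AddSubgroup.zmultiples y) a)
  have hk0 : k = 0 := by
    by_contra hk0
    refine hy (isOfFinAddOrder_iff_zsmul_eq_zero.mpr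
      ⟨p * k, mul_ne_zero (by exact_mod_cast hp.ne_zero) hk0, ?_⟩)
    rw [mul_smul, hk, smul_comm, ha, smul_zero]
  rw [hk0, zero_smul] at hk
  have hcop : Nat.Coprime N p := (Nat.coprime_comm.mp ((Nat.Prime.coprime_iff_not_dvd hp).mpr hidx))
  obtain ⟨u, v, huv⟩ : IsCoprime (N : ℤ) (p : ℤ) := Nat.isCoprime_iff_coprime.mpr hcop
  have hNa : (N : ℤ) • a = 0 := by rw [natCast_zsmul]; exact hk.symm
  calc a = (u * N + v * p : ℤ) • a := by rw [huv, one_smul]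
    _ = 0 := by rw [add_smul, mul_smul, mul_smul, hNa, ha, smul_zero, smul_zero, add_zero]

/-- `p ∤ [A : ℤy]` with `y` of infinite order ⇒ `y ∉ pA`: if `y = p b` then `[A:ℤy] • b = k • y`
gives `([A:ℤy] − p k) • y = 0`, so `p ∣ [A : ℤy]`. [folklore] -/
theorem ne_prime_smul_of_not_dvd_index {p : ℕ} {y : A} (hy : ¬ IsOfFinAddOrder y)
    (hidx : ¬ p ∣ (AddSubgroup.zmultiples y).index) (b : A) : y ≠ (p : ℤ) • b := by
  intro hyb
  set N := (AddSubgroup.zmultiples y).index with hN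
  obtain ⟨k, hk⟩ := AddSubgroup.mem_zmultiples_iff.mp (AddSubgroup.nsmul_index_mem
    (AddSubgroup.zmultiples y) b)
  have h0 : (N : ℤ) • y = ((p : ℤ) * k) • y := by
    rw [mul_smul, hk, smul_comm, ← hyb, hN, natCast_zsmul]
  have h1 : ((N : ℤ) - p * k) • y = 0 := by rw [sub_smul, h0, sub_self]
  have h2 : (N : ℤ) - p * k = 0 := by
    by_contra hne
    exact hy (isOfFinAddOrder_iff_zsmul_eq_zero.mpr ⟨_, hne, h1⟩)
  exact hidx ⟨k.natAbs, by
    have h3 : (N : ℤ) = p * k := sub_eq_zero.mp h2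
    have h4 : (N : ℤ).natAbs = (p * k : ℤ).natAbs := by rw [h3]
    simpa [Int.natAbs_mul] using h4⟩

/-- `p ∤ [A : ℤy]` ⇒ `A = ℤy + pA` (`y` generates `A` modulo `p`): with `[A:ℤy] • a = k • y` and
`u [A:ℤy] + v p = 1`, `a = (u k) • y + p • (v a)`. [folklore] -/
theorem exists_eq_zsmul_add_prime_smul_of_not_dvd_index {p : ℕ} (hp : p.Prime) {y : A}
    (hidx : ¬ p ∣ (AddSubgroup.zmultiples y).index) (a : A) :
    ∃ (n : ℤ) (b : A), a = n • y + (p : ℤ) • b := by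
  set N := (AddSubgroup.zmultiples y).index with hN
  obtain ⟨k, hk⟩ := AddSubgroup.mem_zmultiples_iff.mp (AddSubgroup.nsmul_index_mem
    (AddSubgroup.zmultiples y) a)
  have hcop : Nat.Coprime N p := (Nat.coprime_comm.mp ((Nat.Prime.coprime_iff_not_dvd hp).mpr hidx))
  obtain ⟨u, v, huv⟩ : IsCoprime (N : ℤ) (p : ℤ) := Nat.isCoprime_iff_coprime.mpr hcop
  refine ⟨u * k, v • a, ?_⟩
  have hNa : (N : ℤ) • a = k • y := by rw [natCast_zsmul]; exact hk.symm
  calc a = (u * N + v * p : ℤ) • a := by rw [huv, one_smul]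
    _ = (u * k) • y + (p : ℤ) • v • a := by rw [add_smul, mul_smul, mul_smul, hNa, mul_smul, smul_comm (p : ℤ) v a]

/-- Conversely, **`A = ℤz + pA` with `[A : ℤz]` finite ⇒ `p ∤ [A : ℤz]`**: multiplication by `p`
is onto on the finite quotient `A/ℤz`, hence injective, so the quotient has no element of order
`p` (Cauchy). This is the direction "`φ(y)` generates `E'(K)` modulo `p` ⇒ `E'` passes the
certificate `p ∤ [E'(K) : ℤφ(y)]`". [folklore] -/
theorem not_dvd_index_of_generates {p : ℕ} (hp : p.Prime) {z : A}
    (hfin : (AddSubgroup.zmultiples z).index ≠ 0)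
    (hgen : ∀ a : A, ∃ (n : ℤ) (b : A), a = n • z + (p : ℤ) • b) :
    ¬ p ∣ (AddSubgroup.zmultiples z).index := by
  haveI : Fact p.Prime := ⟨hp⟩
  set H := AddSubgroup.zmultiples z with hH
  haveI : H.FiniteIndex := ⟨hfin⟩
  haveI : Finite (A ⧸ H) := inferInstance
  intro hdvd
  rw [AddSubgroup.index] at hdvd
  obtain ⟨x, hx⟩ := exists_prime_addOrderOf_dvd_card' (G := A ⧸ H) p hdvd
  have hsurj : Function.Surjective (fun m : A ⧸ H ↦ (p : ℤ) • m) := by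
    intro m
    obtain ⟨a, rfl⟩ := QuotientAddGroup.mk_surjective m
    obtain ⟨n, b, hab⟩ := hgen a
    refine ⟨(b : A ⧸ H), ?_⟩
    have hz : ((z : A) : A ⧸ H) = 0 :=
      (QuotientAddGroup.eq_zero_iff z).mpr (AddSubgroup.mem_zmultiples z)
    simp only [hab, QuotientAddGroup.mk_add, QuotientAddGroup.mk_zsmul, hz, smul_zero, zero_add]
  have hinj : Function.Injective (fun m : A ⧸ H ↦ (p : ℤ) • m) :=
    Finite.injective_iff_surjective.mpr hsurj
  have hpx : (p : ℤ) • x = 0 := by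
    rw [natCast_zsmul, ← hx]; exact addOrderOf_nsmul_eq_zero x
  have hx0 : x = 0 := hinj (by simp only [hpx, smul_zero])
  rw [hx0, addOrderOf_zero] at hx
  exact hp.one_lt.ne' hx.symm

end Algebra

/-! ### §2 Kummer degeneration through an isogeny (geometric points, any base field) -/
section Kummer

variable {F : Type u} [Field F] {W W' : WeierstrassCurve F} [W.IsElliptic] [W'.IsElliptic]

omit [W.IsElliptic] [W'.IsElliptic] in
/-- An isogeny maps `Γ_F`-fixed geometric points to `Γ_F`-fixed geometric points
(`φ (σ • P) = σ • φ P`). Silverman, *AEC*, III.4 (isogenies defined over `F`). [folklore] -/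
theorem map_mem_fixedPoints (φ : Isogeny W W') {P : geomPoints W}
    (hP : P ∈ FixedPoints.addSubgroup (absoluteGaloisGroup F) (geomPoints W)) :
    φ P ∈ FixedPoints.addSubgroup (absoluteGaloisGroup F) (geomPoints W') := by
  rw [FixedPoints.mem_addSubgroup] at hP ⊢
  intro σ
  rw [← φ.map_smul, hP σ]

/-- **Kummer degeneration through an isogeny.** Let `φ : E → E'`, `ψ : E' → E` be isogenies of
elliptic curves over `F` with `ψ (φ P) = m • P` on `E(F̄)`. For `y ∈ E(F̄)` the following are
equivalent: (i) `y` has an `m`-th root `Q ∈ E(F̄)` (`m • Q = y`) with `σQ − Q ∈ ker φ` for EVERY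
`σ ∈ Γ_F = Gal(F̄/F)`; (ii) `y = ψ(y')` for some `F`-rational `y' ∈ E'(F) = E'(F̄)^{Γ_F}`.
((i)⇒(ii): `y' = φ Q` is fixed since `φ(σQ) − φ(Q) = φ(σQ − Q) = 0`, and `ψ y' = m Q = y`.
(ii)⇒(i): `φ` is onto `E'(F̄)` (Silverman *AEC* II.2.3, the tree's `Isogeny.surjective`); pick
`Q` with `φ Q = y'`; then `m Q = ψ φ Q = y` and `φ(σQ − Q) = σy' − y' = 0`.) In case (i) the Kummer
extension `F(E[m], Q)/F(E[m])` has Galois group inside `ker φ` (of order `deg φ`), not `E[m]`: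
for `deg φ = m = p` this NEGATES the conclusion `Gal(L(y/p)/L) ≅ E_p` of Gross 1991 Prop. 9.3 for
`S = ⟨δy⟩` (the statement whose conclusion case (i) negates). [folklore] -/
theorem exists_root_iff_exists_fixed_apply_eq (φ : Isogeny W W') (ψ : Isogeny W' W) (m : ℤ)
    (hψφ : ∀ P, ψ (φ P) = m • P) (y : geomPoints W) :
    (∃ Q : geomPoints W, m • Q = y ∧
        ∀ σ : absoluteGaloisGroup F, σ • Q - Q ∈ φ.toAddMonoidHom.ker) ↔
      ∃ y' ∈ FixedPoints.addSubgroup (absoluteGaloisGroup F) (geomPoints W'), ψ y' = y := by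
  constructor
  · rintro ⟨Q, hQ, hσ⟩
    refine ⟨φ Q, ?_, by rw [hψφ, hQ]⟩
    rw [FixedPoints.mem_addSubgroup]
    intro σ
    have h := hσ σ
    rw [AddMonoidHom.mem_ker, Isogeny.coe_toAddMonoidHom, map_sub, φ.map_smul, sub_eq_zero] at h
    exact h
  · rintro ⟨y', hy', rfl⟩
    rw [FixedPoints.mem_addSubgroup] at hy'
    obtain ⟨Q, hQ⟩ := φ.surjective y'
    refine ⟨Q, by rw [← hQ, hψφ], fun σ ↦ ?_⟩
    rw [AddMonoidHom.mem_ker, Isogeny.coe_toAddMonoidHom, map_sub, φ.map_smul, hQ, hy' σ, sub_self]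

/-- **The image point always degenerates.** With `φ (ψ P') = m • P'` on `E'(F̄)` and `y ∈ E(F)`
rational, `φ(y) ∈ E'(F)` has an `m`-th root `Q' ∈ E'(F̄)` with `σQ' − Q' ∈ ker ψ` for every
`σ ∈ Γ_F` (the previous theorem for the pair `(ψ, φ)` with `y' := y`). For a `p`-isogeny
`φ : E → E'` with dual `φ̂` and a Heegner point `y_K`: the Kummer extension of `φ(y_K)` over
`K(E'[p])` has group inside `ker φ̂`, whatever the index of `φ(y_K)` in `E'(K)`. [folklore] -/
theorem exists_root_map_forall_smul_sub_mem_ker (φ : Isogeny W W') (ψ : Isogeny W' W) (m : ℤ)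
    (hφψ : ∀ P', φ (ψ P') = m • P') {y : geomPoints W}
    (hy : y ∈ FixedPoints.addSubgroup (absoluteGaloisGroup F) (geomPoints W)) :
    ∃ Q' : geomPoints W', m • Q' = φ y ∧
      ∀ σ : absoluteGaloisGroup F, σ • Q' - Q' ∈ ψ.toAddMonoidHom.ker :=
  (exists_root_iff_exists_fixed_apply_eq ψ φ m hφψ (φ y)).mpr ⟨y, hy, rfl⟩

/-! ### §3 The dichotomy on a `p`-isogeny edge -/

/-- **One end of every `p`-isogeny edge is Kummer-degenerate (Case A) or the image point is a
certificate generator (Case B).** Let `φ : E → E'`, `ψ : E' → E` be isogenies of elliptic curves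
over `F` with `ψ (φ P) = p • P` (`p` prime; e.g. `deg φ = p`, `ψ = φ̂`). Assume `E(F)` (the
`Γ_F`-fixed points of `E(F̄)`) has no `p`-torsion and `E'(F) = ℤy' + pE'(F)` for some
`y' ∈ E'(F)` (e.g. `E'(F)` of rank one without `p`-torsion; cf. `…_of_not_dvd_index`). Then for
every `y ∈ E(F)`: EITHER there is `Q ∈ E(F̄)` with `p • Q = y` and `σQ − Q ∈ ker φ` for all
`σ ∈ Γ_F` (Case A, `y ∈ ψ(E'(F))`: the Kummer extension `F(E[p], y/p)/F(E[p])` has group inside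
`ker φ`: the conclusion of Gross 1991 Prop. 9.3 fails for `S = ⟨δy⟩`), OR `E'(F) = ℤφ(y) + pE'(F)`
(Case B: `φ(y)` is a "`p ∤` index" certificate point of `E'`, whose own Kummer extension
degenerates inside `ker ψ` by `exists_root_map_forall_smul_sub_mem_ker`). This is §2.3 (i) of the
audit sheet `D-AUDIT-lw16-r1` (cell `bsd-litref`), the structural form of Matar–Nekovář 2019,
Prop. 6.4 (C5)/(C6) "used, respectively, in the proofs of [Gross, Prop. 9.3] and [Prop. 9.5 (2)]"
(JTNB 31, pp. 497–498; §0.10–0.11, p. 457). [folklore] -/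
theorem exists_root_or_generates (φ : Isogeny W W') (ψ : Isogeny W' W) {p : ℕ} (hp : p.Prime)
    (hψφ : ∀ P, ψ (φ P) = (p : ℤ) • P)
    (htf : ∀ a ∈ FixedPoints.addSubgroup (absoluteGaloisGroup F) (geomPoints W),
      (p : ℤ) • a = 0 → a = 0)
    {y' : geomPoints W'} (hy' : y' ∈ FixedPoints.addSubgroup (absoluteGaloisGroup F) (geomPoints W'))
    (hgen : ∀ a' ∈ FixedPoints.addSubgroup (absoluteGaloisGroup F) (geomPoints W'),
      ∃ n : ℤ, ∃ b' ∈ FixedPoints.addSubgroup (absoluteGaloisGroup F) (geomPoints W'),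
        a' = n • y' + (p : ℤ) • b')
    {y : geomPoints W} (hy : y ∈ FixedPoints.addSubgroup (absoluteGaloisGroup F) (geomPoints W)) :
    (∃ Q : geomPoints W, (p : ℤ) • Q = y ∧
        ∀ σ : absoluteGaloisGroup F, σ • Q - Q ∈ φ.toAddMonoidHom.ker) ∨
      ∀ a' ∈ FixedPoints.addSubgroup (absoluteGaloisGroup F) (geomPoints W'),
        ∃ n : ℤ, ∃ b' ∈ FixedPoints.addSubgroup (absoluteGaloisGroup F) (geomPoints W'),
          a' = n • φ y + (p : ℤ) • b' := by
  rcases exists_apply_eq_or_generates (FixedPoints.addSubgroup (absoluteGaloisGroup F) (geomPoints W))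
      (FixedPoints.addSubgroup (absoluteGaloisGroup F) (geomPoints W')) φ.toAddMonoidHom
      ψ.toAddMonoidHom hp (fun a ↦ hψφ a) (fun a' ha' ↦ map_mem_fixedPoints ψ ha') htf hy' hgen hy
      (map_mem_fixedPoints φ hy) with h | h
  · exact Or.inl ((exists_root_iff_exists_fixed_apply_eq φ ψ p hψφ y).mpr h)
  · exact Or.inr h

/-- **… and not both, when `y ∉ pE(F)`.** If `y ∈ E(F)` is not `p` times a rational point, then
Case A (`y` has a `p`-th root `Q` with `σQ − Q ∈ ker φ` for all `σ`, i.e. `y ∈ ψ(E'(F))`) and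
Case B (`E'(F) = ℤφ(y) + pE'(F)`) exclude each other: `y = ψ a'`, `a' = n φ(y) + p b'` would give
`y = p (n y + ψ b') ∈ pE(F)`. With `exists_root_or_generates`: EXACTLY one of the two ends of the
edge carries the degenerate certified point. (For a Heegner point with `p ∤ [E(K) : ℤy_K]`,
`y_K ∉ pE(K)` is `ne_prime_smul_of_not_dvd_index`.) [folklore] -/
theorem not_exists_root_and_generates (φ : Isogeny W W') (ψ : Isogeny W' W) {p : ℕ}
    (hψφ : ∀ P, ψ (φ P) = (p : ℤ) • P) {y : geomPoints W}
    (hy : y ∈ FixedPoints.addSubgroup (absoluteGaloisGroup F) (geomPoints W))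
    (hyp : ∀ b ∈ FixedPoints.addSubgroup (absoluteGaloisGroup F) (geomPoints W), y ≠ (p : ℤ) • b) :
    ¬ ((∃ Q : geomPoints W, (p : ℤ) • Q = y ∧
          ∀ σ : absoluteGaloisGroup F, σ • Q - Q ∈ φ.toAddMonoidHom.ker) ∧
        ∀ a' ∈ FixedPoints.addSubgroup (absoluteGaloisGroup F) (geomPoints W'),
          ∃ n : ℤ, ∃ b' ∈ FixedPoints.addSubgroup (absoluteGaloisGroup F) (geomPoints W'),
            a' = n • φ y + (p : ℤ) • b') := by
  rintro ⟨hA, hB⟩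
  obtain ⟨a', ha', hψa'⟩ := (exists_root_iff_exists_fixed_apply_eq φ ψ p hψφ y).mp hA
  exact not_exists_eq_zsmul_add_of_apply_eq
    (FixedPoints.addSubgroup (absoluteGaloisGroup F) (geomPoints W))
    (FixedPoints.addSubgroup (absoluteGaloisGroup F) (geomPoints W')) φ.toAddMonoidHom
    ψ.toAddMonoidHom (fun a ↦ hψφ a) (fun a' ha' ↦ map_mem_fixedPoints ψ ha') hy hyp hψa'
    (hB a' ha')

/-! ### §4 The edge dichotomy in the certificate currency `p ∤ [E(F) : ℤy]` -/

/-- **Exactly one end, in index currency.** Let `φ : E → E'`, `ψ : E' → E` be isogenies of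
elliptic curves over `F` with `ψ ∘ φ = [p]`, `p` prime. Let `y ∈ E(F)` be of infinite order with
`p ∤ [E(F) : ℤy]` (the `m₀ = 0` certificate of the Kolyvagin binders, for `y = y_K` a Heegner
point) and let `y' ∈ E'(F)` satisfy `p ∤ [E'(F) : ℤy']` (e.g. `E'(F)` of rank one without
`p`-torsion). Then EXACTLY ONE of: (A) `y` has a `p`-th root `Q ∈ E(F̄)` with `σQ − Q ∈ ker φ`
for every `σ ∈ Γ_F` (the Kummer extension of `y` degenerates inside `ker φ`; Gross 1991
Prop. 9.3 fails for `S = ⟨δy⟩`); (B) `E'(F) = ℤφ(y) + pE'(F)` (`φ(y)` is a certificate point of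
`E'`, and ITS Kummer extension degenerates inside `ker ψ`, `exists_root_map_forall_smul_sub_mem_ker`).
(`E(F)`, `E'(F)` = the `Γ_F`-fixed subgroups of `E(F̄)`, `E'(F̄)`; Matar–Nekovář 2019, Prop. 6.4
(C5)–(C6), is the printed diagnosis this makes concrete.) [folklore] -/
theorem exists_root_xor_generates_of_not_dvd_index (φ : Isogeny W W') (ψ : Isogeny W' W)
    {p : ℕ} (hp : p.Prime) (hψφ : ∀ P, ψ (φ P) = (p : ℤ) • P)
    (y : FixedPoints.addSubgroup (absoluteGaloisGroup F) (geomPoints W))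
    (hyord : ¬ IsOfFinAddOrder y) (hidx : ¬ p ∣ (AddSubgroup.zmultiples y).index)
    (y' : FixedPoints.addSubgroup (absoluteGaloisGroup F) (geomPoints W'))
    (hidx' : ¬ p ∣ (AddSubgroup.zmultiples y').index) :
    Xor (∃ Q : geomPoints W, (p : ℤ) • Q = y ∧
        ∀ σ : absoluteGaloisGroup F, σ • Q - Q ∈ φ.toAddMonoidHom.ker)
      (∀ a' ∈ FixedPoints.addSubgroup (absoluteGaloisGroup F) (geomPoints W'),
        ∃ n : ℤ, ∃ b' ∈ FixedPoints.addSubgroup (absoluteGaloisGroup F) (geomPoints W'),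
          a' = n • φ y + (p : ℤ) • b') := by
  have htf : ∀ a ∈ FixedPoints.addSubgroup (absoluteGaloisGroup F) (geomPoints W),
      (p : ℤ) • a = 0 → a = 0 := by
    intro a ha h
    have h' : (p : ℤ) • (⟨a, ha⟩ : FixedPoints.addSubgroup (absoluteGaloisGroup F) (geomPoints W))
        = 0 := Subtype.ext (by simpa using h)
    exact congrArg Subtype.val (eq_zero_of_prime_smul_eq_zero_of_not_dvd_index hp hyord hidx h')
  have hyp : ∀ b ∈ FixedPoints.addSubgroup (absoluteGaloisGroup F) (geomPoints W),
      (y : geomPoints W) ≠ (p : ℤ) • b := by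
    intro b hb h
    exact ne_prime_smul_of_not_dvd_index hyord hidx ⟨b, hb⟩ (Subtype.ext (by simpa using h))
  have hgen : ∀ a' ∈ FixedPoints.addSubgroup (absoluteGaloisGroup F) (geomPoints W'),
      ∃ n : ℤ, ∃ b' ∈ FixedPoints.addSubgroup (absoluteGaloisGroup F) (geomPoints W'),
        a' = n • (y' : geomPoints W') + (p : ℤ) • b' := by
    intro a' ha'
    obtain ⟨n, b, h⟩ := exists_eq_zsmul_add_prime_smul_of_not_dvd_index hp hidx' ⟨a', ha'⟩
    exact ⟨n, b, b.2, by simpa using congrArg Subtype.val h⟩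
  have hor := exists_root_or_generates φ ψ hp hψφ htf y'.2 hgen y.2
  have hnand := not_exists_root_and_generates φ ψ hψφ y.2 hyp
  rcases hor with hA | hB
  · exact Or.inl ⟨hA, fun hB ↦ hnand ⟨hA, hB⟩⟩
  · exact Or.inr ⟨hB, fun hA ↦ hnand ⟨hA, hB⟩⟩

omit [W.IsElliptic] [W'.IsElliptic] in
/-- **Case B in index currency**: if `φ(y)` generates `E'(F)` modulo `p` and `[E'(F) : ℤφ(y)]`
is finite, then `p ∤ [E'(F) : ℤφ(y)]` — `E'` passes the certificate with the point `φ(y)`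
(`not_dvd_index_of_generates` in `E'(F)`). Along a `p`-isogeny the index of the image of a
certificate point thus changes by the factor `#coker ∈ {1, p}` (sheet §2.3 (i), §4). [folklore] -/
theorem not_dvd_index_map_of_generates (φ : Isogeny W W') {p : ℕ} (hp : p.Prime)
    (y : FixedPoints.addSubgroup (absoluteGaloisGroup F) (geomPoints W))
    (hfin : (AddSubgroup.zmultiples (⟨φ y, map_mem_fixedPoints φ y.2⟩ :
      FixedPoints.addSubgroup (absoluteGaloisGroup F) (geomPoints W'))).index ≠ 0)
    (hB : ∀ a' ∈ FixedPoints.addSubgroup (absoluteGaloisGroup F) (geomPoints W'),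
      ∃ n : ℤ, ∃ b' ∈ FixedPoints.addSubgroup (absoluteGaloisGroup F) (geomPoints W'),
        a' = n • φ y + (p : ℤ) • b') :
    ¬ p ∣ (AddSubgroup.zmultiples (⟨φ y, map_mem_fixedPoints φ y.2⟩ :
      FixedPoints.addSubgroup (absoluteGaloisGroup F) (geomPoints W'))).index := by
  refine not_dvd_index_of_generates hp hfin fun a ↦ ?_
  obtain ⟨n, b', hb', h⟩ := hB a a.2
  exact ⟨n, ⟨b', hb'⟩, Subtype.ext (by simpa using h)⟩

end Kummer
end Summit.BirchSwinnertonDyer.Rank1Residual.LW16.IsogenyEdge
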